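import Mathlib
import HarnessLib
import Summits.Ventures.LatticeQCDFlow.Exactness.NCMCGeneralSpaceMartingaleProduct

/-!
# A martingale central limit theorem (McLeish, bounded increments): `(√n)⁻¹ Σ_{t<n} D_t ⇒ N(0, σ²)` whenever the `D_t` are bounded, orthogonal to their past, and `(1/n) Σ_{t<n} D_t² → σ²` almost surely

HONEST FRAMING: exact (Metropolis-corrected) sampling algorithms for lattice gauge theory;
figures of merit are autocorrelation/cost numbers at stated couplings and volumes; no
continuum-physics claim.

Venture `LatticeQCDFlow` (cell pub-lqcd), topic `Exactness`; FANOUT row 13 (`eng-snf`, GEN-19).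
NEW WORK of the cell (a Lean proof of a textbook theorem against Mathlib's characteristic functions
and Lévy's continuity theorem `MeasureTheory.ProbabilityMeasure.tendsto_iff_tendsto_charFun`), not a
published result of ours; no definition is introduced; nothing is cited as a fact — the statement is
the bounded-increment case of McLeish's martingale central limit theorem (D. L. McLeish, *Dependent
central limit theorems and invariance principles*, Ann. Probab. 2 (1974) 620–628, Thm 2.3; Hall–Heyde,
*Martingale Limit Theory and its Application* (1980), Thm 3.2), NAMED ONLY.  To our knowledge Mathlib
has the i.i.d. central limit theorem only (`ProbabilityTheory.tendstoInDistribution_inv_sqrt_mul_sum_sub`);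
the cell's chain CLT `Scoring.markovChain_clt` (row 8) is regenerative and needs a ONE-step
whole-space minorisation.  WHY (row 13): the iteration kernel of the engine's NCMC lane
(`run_ncmc_chain`) has only a TWO-step Doeblin minorisation (GEN-18,
`NCMCGeneralSpaceOccupancyChainDoeblin`); the martingale route (this file, the product lemmas of
`NCMCGeneralSpaceMartingaleProduct.lean`, and the Poisson equation in
`NCMCGeneralSpaceDoeblinPowerCLT.lean`) gives the CLT for every kernel with a Doeblin POWER, hence
CLT-width error bars for the reported occupancy and `dF_occ` — GEN-18's named gap.

## Content (`P` a probability measure, `D : ℕ → Ω → ℝ` measurable with `|D_t| ≤ C`,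
## `∫ F(D_0,…,D_{n−1}) · D_n dP = 0` for all `n` and all bounded measurable `F : (Fin n → ℝ) → ℝ`)

* **`tendsto_integral_exp_mul_sum_of_orthogonal`** — THE ANALYTIC CORE: if
  `(1/n) Σ_{t<n} D_t² → σ²` almost surely then for every real `u`,
  `∫ exp(i u (√n)⁻¹ Σ_{t<n} D_t) dP → exp(−σ²u²/2)`.  Proof (McLeish): with `a = u/√n`,
  `e^{iaS_n} = Z_n · U_n`, `Z_n = Π(1 + iaD_t)` has mean `1`
  (`integral_prod_one_add_mul_I_eq_one`) and `‖Z_n‖ ≤ e^{u²C²/2}`, while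
  `U_n = Π e^{iaD_t}/(1 + iaD_t) = exp(−(u²/2)(1/n)ΣD_t² − R_n)` (`prod_exp_div_eq_exp`) with
  `‖R_n‖ ≤ (2/3)|u|³|C|³/√n` and `‖U_n‖ ≤ 1`; hence
  `|E e^{iaS_n} − e^{−σ²u²/2}| = |E[Z_n (U_n − e^{−σ²u²/2})]| ≤ e^{u²C²/2} E‖U_n − e^{−σ²u²/2}‖ → 0`
  by dominated convergence.
* **`tendstoInDistribution_sum_div_sqrt_of_orthogonal`** — THE THEOREM: for every `Y` with law
  `N(0, σ²)` (`σ² ≥ 0`), `TendstoInDistribution (fun n ω => (√n)⁻¹ Σ_{t<n} D_t ω) atTop Y (fun _ => P) P'`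
  (Lévy's continuity theorem, `charFun_gaussianReal`).

NOT CLAIMED: unbounded increments / Lindeberg-type conditions, convergence of the quadratic variation
in probability only (almost sure convergence is assumed — what the ergodic theorem delivers in the
Markov-chain application), random normalisations, rates (Berry–Esseen), functional versions.
-/

namespace Summit.Ventures.LatticeQCDFlow.Exactness.GeneralNCMC

open MeasureTheory ProbabilityTheory Filter Finset Complex
open scoped Topology Real

section CLT

variable {Ω : Type*} [MeasurableSpace Ω] {P : Measure Ω} [IsProbabilityMeasure P] {D : ℕ → Ω → ℝ}

/-- **THE ANALYTIC CORE (McLeish).**  Bounded increments orthogonal to their past with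
`(1/n) Σ_{t<n} D_t² → σ²` almost surely: for every real `u`,
`∫ exp(i u (√n)⁻¹ Σ_{t<n} D_t) dP → exp(−σ² u²/2)`. -/
theorem tendsto_integral_exp_mul_sum_of_orthogonal (hDm : ∀ t, Measurable (D t)) {C : ℝ}
    (hC : ∀ t ω, |D t ω| ≤ C)
    (horth : ∀ (n : ℕ) (F : (Fin n → ℝ) → ℝ) (K : ℝ), Measurable F → (∀ v, |F v| ≤ K) →
      ∫ ω, F (fun i => D i ω) * D n ω ∂P = 0)
    {σ2 : ℝ}
    (hQV : ∀ᵐ ω ∂P, Tendsto (fun n : ℕ => (∑ t ∈ range n, D t ω ^ 2) / n) atTop (𝓝 σ2))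
    (u : ℝ) :
    Tendsto (fun n : ℕ =>
        ∫ ω, Complex.exp ((u : ℂ) * (((Real.sqrt n)⁻¹ * ∑ t ∈ range n, D t ω : ℝ) : ℂ) * I) ∂P)
      atTop (𝓝 (Complex.exp (-((σ2 : ℂ) * u ^ 2 / 2)))) := by
  -- notation: `a n = u/√n`, `c` the limit
  set a : ℕ → ℝ := fun n => u * (Real.sqrt n)⁻¹ with ha
  set c : ℂ := Complex.exp (-((σ2 : ℂ) * u ^ 2 / 2)) with hc
  -- `e^{i a S_n} = Z_n · U_n`
  have hexp : ∀ (n : ℕ) (ω : Ω),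
      Complex.exp ((u : ℂ) * (((Real.sqrt n)⁻¹ * ∑ t ∈ range n, D t ω : ℝ) : ℂ) * I)
      = (∏ t ∈ range n, ((1 : ℂ) + ((a n * D t ω : ℝ) : ℂ) * I)) *
        ∏ t ∈ range n, Complex.exp (((a n * D t ω : ℝ) : ℂ) * I)
          / (1 + ((a n * D t ω : ℝ) : ℂ) * I) := by
    intro n ω
    rw [← Finset.prod_mul_distrib]
    have hfac : ∀ t ∈ range n, ((1 : ℂ) + ((a n * D t ω : ℝ) : ℂ) * I) *
        (Complex.exp (((a n * D t ω : ℝ) : ℂ) * I) / (1 + ((a n * D t ω : ℝ) : ℂ) * I))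
        = Complex.exp (((a n * D t ω : ℝ) : ℂ) * I) := fun t _ =>
      mul_div_cancel₀ _ (fun h => by simpa using congrArg Complex.re h)
    rw [Finset.prod_congr rfl hfac, ← Complex.exp_sum]
    congr 1
    rw [ha]
    push_cast
    rw [Finset.mul_sum, Finset.mul_sum, Finset.sum_mul]
    exact Finset.sum_congr rfl fun t _ => by ring
  -- measurability of `U_n`
  have hUm : ∀ n, Measurable fun ω => ∏ t ∈ range n, Complex.exp (((a n * D t ω : ℝ) : ℂ) * I)
      / (1 + ((a n * D t ω : ℝ) : ℂ) * I) := by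
    intro n
    refine Finset.measurable_prod _ fun t _ => ?_
    have h1 : Measurable fun ω => ((a n * D t ω : ℝ) : ℂ) * I :=
      (Complex.measurable_ofReal.comp ((hDm t).const_mul (a n))).mul_const I
    exact (Complex.measurable_exp.comp h1).div (measurable_const.add h1)
  -- `‖Z_n‖ ≤ e^{u²C²/2}` for `n ≥ 1`
  have hZle : ∀ n, 1 ≤ n → ∀ ω,
      ‖∏ t ∈ range n, ((1 : ℂ) + ((a n * D t ω : ℝ) : ℂ) * I)‖ ≤ Real.exp (u ^ 2 * C ^ 2 / 2) := by
    intro n hn ω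
    refine (norm_prod_one_add_mul_I_le_exp (fun t => a n * D t ω) n).trans ?_
    refine Real.exp_le_exp.2 (div_le_div_of_nonneg_right ?_ (by norm_num))
    have hn' : (0 : ℝ) < n := by exact_mod_cast hn
    have han : a n ^ 2 * n = u ^ 2 := by
      rw [ha]
      dsimp only
      rw [mul_pow, inv_pow, Real.sq_sqrt hn'.le]
      field_simp
    calc ∑ t ∈ range n, (a n * D t ω) ^ 2 ≤ ∑ _t ∈ range n, a n ^ 2 * C ^ 2 := by
          refine Finset.sum_le_sum fun t _ => ?_
          rw [mul_pow]
          refine mul_le_mul_of_nonneg_left ?_ (sq_nonneg _)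
          calc D t ω ^ 2 = |D t ω| ^ 2 := (sq_abs _).symm
            _ ≤ C ^ 2 := pow_le_pow_left₀ (abs_nonneg _) (hC t ω) 2
      _ = u ^ 2 * C ^ 2 := by
          rw [Finset.sum_const, Finset.card_range, nsmul_eq_mul]
          calc (n : ℝ) * (a n ^ 2 * C ^ 2) = (a n ^ 2 * n) * C ^ 2 := by ring
            _ = u ^ 2 * C ^ 2 := by rw [han]
  -- `U_n → c` almost surely
  have hUlim : ∀ᵐ ω ∂P, Tendsto (fun n => ∏ t ∈ range n, Complex.exp (((a n * D t ω : ℝ) : ℂ) * I)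
      / (1 + ((a n * D t ω : ℝ) : ℂ) * I)) atTop (𝓝 c) := by
    filter_upwards [hQV] with ω hω
    simp_rw [prod_exp_div_eq_exp (fun t => a _ * D t ω)]
    rw [hc]
    refine ((Complex.continuous_exp.tendsto _).comp ?_)
    -- the exponent converges to `−σ²u²/2 − 0`
    have hmain : Tendsto (fun n : ℕ => -(((∑ t ∈ range n, (a n * D t ω) ^ 2 : ℝ) : ℂ) / 2))
        atTop (𝓝 (-((σ2 : ℂ) * u ^ 2 / 2))) := by
      have h1 : Tendsto (fun n : ℕ => u ^ 2 * ((∑ t ∈ range n, D t ω ^ 2) / n)) atTop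
          (𝓝 (u ^ 2 * σ2)) := hω.const_mul _
      have h2 : (fun n : ℕ => (∑ t ∈ range n, (a n * D t ω) ^ 2 : ℝ)) =ᶠ[atTop]
          fun n : ℕ => u ^ 2 * ((∑ t ∈ range n, D t ω ^ 2) / n) := by
        filter_upwards [eventually_ge_atTop 1] with n hn
        have hn' : (0 : ℝ) < n := by exact_mod_cast hn
        have han : a n ^ 2 = u ^ 2 / n := by
          rw [ha]
          dsimp only
          rw [mul_pow, inv_pow, Real.sq_sqrt hn'.le, div_eq_mul_inv]
        simp_rw [mul_pow, ← Finset.mul_sum, han]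
        field_simp
      have h3 : Tendsto (fun n : ℕ => (∑ t ∈ range n, (a n * D t ω) ^ 2 : ℝ)) atTop
          (𝓝 (u ^ 2 * σ2)) := h1.congr' (h2.mono fun n hn => hn.symm)
      have h4 : Tendsto (fun n : ℕ => ((∑ t ∈ range n, (a n * D t ω) ^ 2 : ℝ) : ℂ)) atTop
          (𝓝 (((u ^ 2 * σ2 : ℝ)) : ℂ)) := (Complex.continuous_ofReal.tendsto _).comp h3
      have h5 := (h4.div_const (2 : ℂ)).neg
      convert h5 using 2
      push_cast
      ring
    have hrem : Tendsto (fun n : ℕ => ∑ t ∈ range n,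
        (Complex.log (1 + ((a n * D t ω : ℝ) : ℂ) * I)
          - (((a n * D t ω : ℝ) : ℂ) * I + ((a n * D t ω : ℝ) : ℂ) ^ 2 / 2))) atTop (𝓝 0) := by
      -- `‖R_n‖ ≤ (2/3)|u|³|C|³/√n` once `|u||C|/√n ≤ 1/2`
      have hbound : Tendsto (fun n : ℕ => 2 / 3 * (|u| ^ 3 * |C| ^ 3 * (Real.sqrt n)⁻¹)) atTop
          (𝓝 0) := by
        have h0 : Tendsto (fun n : ℕ => (Real.sqrt n)⁻¹) atTop (𝓝 0) :=
          tendsto_inv_atTop_zero.comp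
            (Real.tendsto_sqrt_atTop.comp tendsto_natCast_atTop_atTop)
        simpa using (h0.const_mul (|u| ^ 3 * |C| ^ 3)).const_mul (2 / 3 : ℝ)
      have hsmall : ∀ᶠ n : ℕ in atTop, |u| * |C| * (Real.sqrt n)⁻¹ ≤ 1 / 2 := by
        have h0 : Tendsto (fun n : ℕ => |u| * |C| * (Real.sqrt n)⁻¹) atTop (𝓝 0) := by
          have h0 : Tendsto (fun n : ℕ => (Real.sqrt n)⁻¹) atTop (𝓝 0) :=
            tendsto_inv_atTop_zero.comp
              (Real.tendsto_sqrt_atTop.comp tendsto_natCast_atTop_atTop)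
          simpa using h0.const_mul (|u| * |C|)
        exact (h0.eventually (ge_mem_nhds (by norm_num : (0 : ℝ) < 1 / 2)))
      refine squeeze_zero_norm' ?_ hbound
      filter_upwards [hsmall, eventually_ge_atTop 1] with n hn hn1
      have hn' : (0 : ℝ) < n := by exact_mod_cast hn1
      have hxt : ∀ t ∈ range n, |a n * D t ω| ≤ 1 / 2 := by
        intro t _
        rw [abs_mul, ha]
        dsimp only
        rw [abs_mul, abs_inv, abs_of_nonneg (Real.sqrt_nonneg _)]
        calc |u| * (Real.sqrt n)⁻¹ * |D t ω| ≤ |u| * (Real.sqrt n)⁻¹ * |C| :=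
              mul_le_mul_of_nonneg_left ((hC t ω).trans (le_abs_self C)) (by positivity)
          _ = |u| * |C| * (Real.sqrt n)⁻¹ := by ring
          _ ≤ 1 / 2 := hn
      refine (norm_sum_rho_le (fun t => a n * D t ω) n hxt).trans ?_
      refine mul_le_mul_of_nonneg_left ?_ (by norm_num)
      calc ∑ t ∈ range n, |a n * D t ω| ^ 3 ≤ ∑ _t ∈ range n, (|u| * (Real.sqrt n)⁻¹ * |C|) ^ 3 := by
            refine Finset.sum_le_sum fun t _ => pow_le_pow_left₀ (abs_nonneg _) ?_ 3
            rw [abs_mul, ha]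
            dsimp only
            rw [abs_mul, abs_inv, abs_of_nonneg (Real.sqrt_nonneg _)]
            exact mul_le_mul_of_nonneg_left ((hC t ω).trans (le_abs_self C)) (by positivity)
        _ = |u| ^ 3 * |C| ^ 3 * (Real.sqrt n)⁻¹ := by
            rw [Finset.sum_const, Finset.card_range, nsmul_eq_mul]
            have hs : Real.sqrt n ≠ 0 := (Real.sqrt_pos.2 hn').ne'
            have key : (n : ℝ) * (Real.sqrt n)⁻¹ ^ 3 = (Real.sqrt n)⁻¹ := by
              have h1 : (n : ℝ) = Real.sqrt n * Real.sqrt n := (Real.mul_self_sqrt hn'.le).symm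
              calc (n : ℝ) * (Real.sqrt n)⁻¹ ^ 3
                  = (Real.sqrt n * Real.sqrt n) * (Real.sqrt n)⁻¹ ^ 3 := by rw [← h1]
                _ = (Real.sqrt n)⁻¹ := by field_simp
            calc (n : ℝ) * (|u| * (Real.sqrt n)⁻¹ * |C|) ^ 3
                = |u| ^ 3 * |C| ^ 3 * ((n : ℝ) * (Real.sqrt n)⁻¹ ^ 3) := by ring
              _ = _ := by rw [key]
    have := hmain.sub hrem
    simpa using this
  -- `Z_n` has mean one, so `∫ e^{iaS_n} − c = ∫ Z_n (U_n − c)`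
  have hdiff : ∀ n : ℕ,
      ∫ ω, Complex.exp ((u : ℂ) * (((Real.sqrt n)⁻¹ * ∑ t ∈ range n, D t ω : ℝ) : ℂ) * I) ∂P - c = ∫ ω, (∏ t ∈ range n, ((1 : ℂ) + ((a n * D t ω : ℝ) : ℂ) * I)) *
        (∏ t ∈ range n, Complex.exp (((a n * D t ω : ℝ) : ℂ) * I) / (1 + ((a n * D t ω : ℝ) : ℂ) * I)
          - c) ∂P := by
    intro n
    have hZm := measurable_prod_one_add_mul_I hDm (a n) n
    have hZint : Integrable (fun ω => ∏ t ∈ range n, ((1 : ℂ) + ((a n * D t ω : ℝ) : ℂ) * I)) P :=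
      Integrable.of_bound hZm.aestronglyMeasurable ((1 + |a n| * |C|) ^ n)
        (ae_of_all _ (norm_prod_one_add_mul_I_le_pow (a n) hC n))
    have hZUint : Integrable (fun ω => (∏ t ∈ range n, ((1 : ℂ) + ((a n * D t ω : ℝ) : ℂ) * I)) *
        ∏ t ∈ range n, Complex.exp (((a n * D t ω : ℝ) : ℂ) * I)
          / (1 + ((a n * D t ω : ℝ) : ℂ) * I)) P := by
      refine Integrable.of_bound (hZm.mul (hUm n)).aestronglyMeasurable ((1 + |a n| * |C|) ^ n)
        (ae_of_all _ fun ω => ?_)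
      rw [norm_mul]
      calc _ ≤ (1 + |a n| * |C|) ^ n * 1 :=
            mul_le_mul (norm_prod_one_add_mul_I_le_pow (a n) hC n ω)
              (norm_prod_exp_div_le_one _ n) (norm_nonneg _) (pow_nonneg (by positivity) _)
        _ = _ := mul_one _
    simp_rw [mul_sub, hexp]
    rw [integral_sub hZUint (hZint.mul_const c), integral_mul_const,
      integral_prod_one_add_mul_I_eq_one hDm hC horth (a n) n, one_mul]
  -- dominated convergence: `∫ ‖U_n − c‖ → 0`
  have hL1 : Tendsto (fun n => ∫ ω, ‖(∏ t ∈ range n, Complex.exp (((a n * D t ω : ℝ) : ℂ) * I)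
      / (1 + ((a n * D t ω : ℝ) : ℂ) * I)) - c‖ ∂P) atTop (𝓝 0) := by
    have h := tendsto_integral_of_dominated_convergence (μ := P)
      (F := fun n ω => ‖(∏ t ∈ range n, Complex.exp (((a n * D t ω : ℝ) : ℂ) * I)
        / (1 + ((a n * D t ω : ℝ) : ℂ) * I)) - c‖) (f := fun _ => (0 : ℝ)) (fun _ => 1 + ‖c‖)
      (fun n => ((hUm n).sub_const c).norm.aestronglyMeasurable) (integrable_const _)
      (fun n => ae_of_all _ fun ω => ?_) ?_
    · simpa using h
    · rw [Real.norm_eq_abs, abs_norm]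
      exact (norm_sub_le _ _).trans (add_le_add (norm_prod_exp_div_le_one _ n) le_rfl)
    · filter_upwards [hUlim] with ω hω
      have := (tendsto_sub_nhds_zero_iff.2 hω).norm
      simpa using this
  -- conclusion
  rw [← tendsto_sub_nhds_zero_iff]
  have hg := hL1.const_mul (Real.exp (u ^ 2 * C ^ 2 / 2))
  rw [mul_zero] at hg
  refine squeeze_zero_norm' ?_ hg
  filter_upwards [eventually_ge_atTop 1] with n hn
  rw [hdiff n]
  refine (norm_integral_le_integral_norm _).trans ?_
  rw [← integral_const_mul]
  have hUcint : Integrable (fun ω => ‖(∏ t ∈ range n, Complex.exp (((a n * D t ω : ℝ) : ℂ) * I)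
      / (1 + ((a n * D t ω : ℝ) : ℂ) * I)) - c‖) P := by
    refine Integrable.of_bound ((hUm n).sub_const c).norm.aestronglyMeasurable (1 + ‖c‖)
      (ae_of_all _ fun ω => ?_)
    rw [Real.norm_eq_abs, abs_norm]
    exact (norm_sub_le _ _).trans (add_le_add (norm_prod_exp_div_le_one _ n) le_rfl)
  refine integral_mono_of_nonneg (ae_of_all _ fun ω => norm_nonneg _) (hUcint.const_mul _)
    (ae_of_all _ fun ω => ?_)
  dsimp only
  rw [norm_mul]
  exact mul_le_mul_of_nonneg_right (hZle n hn ω) (norm_nonneg _)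

/-- **THE MARTINGALE CENTRAL LIMIT THEOREM (McLeish; bounded increments, natural filtration).**
`D_t` measurable with `|D_t| ≤ C`, `∫ F(D_0, …, D_{n−1}) · D_n dP = 0` for every `n` and every bounded
measurable `F`, and `(1/n) Σ_{t<n} D_t² → σ²` almost surely (`0 ≤ σ²`).  Then for every real random
variable `Y` with law `N(0, σ²)`:
`TendstoInDistribution (fun n ω => (√n)⁻¹ Σ_{t<n} D_t ω) atTop Y (fun _ => P) P'`. -/
theorem tendstoInDistribution_sum_div_sqrt_of_orthogonal (hDm : ∀ t, Measurable (D t)) {C : ℝ}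
    (hC : ∀ t ω, |D t ω| ≤ C)
    (horth : ∀ (n : ℕ) (F : (Fin n → ℝ) → ℝ) (K : ℝ), Measurable F → (∀ v, |F v| ≤ K) →
      ∫ ω, F (fun i => D i ω) * D n ω ∂P = 0)
    {σ2 : ℝ} (hσ2 : 0 ≤ σ2)
    (hQV : ∀ᵐ ω ∂P, Tendsto (fun n : ℕ => (∑ t ∈ range n, D t ω ^ 2) / n) atTop (𝓝 σ2))
    {Ω' : Type*} [MeasurableSpace Ω'] {P' : Measure Ω'} [IsProbabilityMeasure P'] {Y : Ω' → ℝ}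
    (hY : HasLaw Y (gaussianReal 0 σ2.toNNReal) P') :
    TendstoInDistribution (fun (n : ℕ) ω => (Real.sqrt n)⁻¹ * ∑ t ∈ range n, D t ω) atTop Y
      (fun _ => P) P' := by
  have hXm : ∀ n : ℕ, Measurable fun ω => (Real.sqrt n)⁻¹ * ∑ t ∈ range n, D t ω := fun n =>
    measurable_const.mul (Finset.measurable_sum _ fun t _ => hDm t)
  refine ⟨fun n => (hXm n).aemeasurable, hY.aemeasurable, ?_⟩
  refine ProbabilityMeasure.tendsto_iff_tendsto_charFun.2 fun v => ?_
  have hL : ∀ n : ℕ, charFun (P.map fun ω => (Real.sqrt n)⁻¹ * ∑ t ∈ range n, D t ω) v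
      = ∫ ω, Complex.exp ((v : ℂ) * (((Real.sqrt n)⁻¹ * ∑ t ∈ range n, D t ω : ℝ) : ℂ) * I) ∂P := by
    intro n
    rw [charFun_apply_real, integral_map (hXm n).aemeasurable (by fun_prop)]
  have hR : charFun (P'.map Y) v = Complex.exp (-((σ2 : ℂ) * v ^ 2 / 2)) := by
    rw [hY.map_eq, charFun_gaussianReal, Real.coe_toNNReal _ hσ2]
    congr 1
    push_cast
    ring
  simp only [ProbabilityMeasure.coe_mk, hL, hR]
  exact tendsto_integral_exp_mul_sum_of_orthogonal hDm hC horth hQV v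

end CLT

end Summit.Ventures.LatticeQCDFlow.Exactness.GeneralNCMC
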